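import Literature.MathematicalPhysics.QuantumLattice.DWaveSourceNNNHoppingWindowCertificateKKT
import Literature.MathematicalPhysics.QuantumLattice.GroundStateSectorAverage
import Literature.MathematicalPhysics.QuantumLattice.PairCorrelationsB1gCharProofs
import HarnessLib

/-!
# Window certificates with a KKT block for the pair-sourced `t–t'` Hubbard tori: the ENERGY FLOOR

Topic `MathematicalPhysics/QuantumLattice`, family `hubbard`. Sequel of
`DWaveSourceNNNHoppingWindowCertificateKKT.lean` (observable rows with a state-optimality block
`kktForm H^{src,tt'}_{Λ'} G (Γ(incl) ∘ B)`, arbitrary window generators, read in the orbit state of every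
`S^z`-eigenvector GROUND state of `A_L = dWaveSourceTorusTT' L tp U μ h`) and of the energy theorem
`dWaveSourceTorusTT'_groundEnergy_ge_of_window_certificate_d4` of `DWaveSourceNNNHoppingWindowCertificate.lean`
(no KKT block). Here: the ENERGY identity may carry the KKT block too —

  `E^{src,tt'} − c·1 = SOS + Σ[H^{src,tt'}_{Λ'}, Γ(incl)Bₖ] + Σ(affine-D₄ defects, χ_{B₁g}(γₗ) = 1) + Σ bⱼ wⱼ
   + Σ dₘ(Vₘᴴ − Vₘ) + Σ aₖ vₖ + kktForm H^{src,tt'}_{Λ'} G (Γ(incl) ∘ B)`  ⇒  `(c − Σₖ ‖aₖ‖)·L² ≤ E₀(A_L)`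

for every `L ≥ 3` with `x ↦ x mod L` injective on `thicken Λ' 1`
(`dWaveSourceTorusTT'_groundEnergy_ge_of_window_certificate_d4_kkt`, + `_eventually` in library instances) —
the energy FLOOR slot of the pinning-field menus (`Summit.Ventures.CertifiedManyBodySolver.SourcedEnergyLowerRow`,
the primary input of the Hellmann–Feynman chords) with ground-state ("KKT", second-order perturbative
positivity, Araújo et al. Prop. 11 / Bratteli–Robinson II Prop. 5.3.19) rows admitted. It is a COROLLARY of
the observable row `re_orbitState_ge_of_sourced_window_certificate_d4_TT'_kkt_ineq` read with the zero
objective and the energy constraint of weight one in the orbit state of ONE `S^z`-eigenvector ground vector,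
which exists because `S^z` is a diagonal charge conserved by `A_L`
(`exists_unit_groundState_mem_fockSpinZSector`, from the fibre decomposition of `GroundStateSectorAverage`);
the label set is the kernel of `χ_{B₁g}` (closed under products, `b1gChar_mul_holds`).

HONEST SCOPE: soundness only — no certificate is constructed or claimed; a bound at fixed `h > 0` says
nothing about `d`-wave order of the Hubbard model. Everything is PROVED; no definition, no named fact.

References: [cite: AraujoEtAl2023, §3.2 Prop. 11] [cite: BratteliRobinsonII1997, Prop. 5.3.19]
[cite: Han2020Bootstrap, §3] [cite: WangEtAl2024, §III] [cite: KomaTasaki1994, §1]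
-/
noncomputable section

namespace Literature.MathematicalPhysics.QuantumLattice

open Matrix Finset HubbardWave0 Literature.Probability.LatticeModels
open Literature.MathematicalPhysics.QuantumManyBody.StateRelaxation
open scoped ComplexOrder BigOperators

/-! ## §1 A charge-conserving Hamiltonian on the Fock space has an `S^z`-eigenvector ground vector -/

section SectorGroundState

variable {Λ : Type*} [LinearOrder Λ] [Fintype Λ]

/-- `S^z` as a REAL diagonal charge (from `LiebThm1.spinZ_eq_diagonal`). [folklore] -/
private theorem spinZ_eq_diagonal_ofReal_lit :
    (HubbardWave0.spinZ : Matrix (Finset (Orb Λ)) (Finset (Orb Λ)) ℂ) =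
      diagonal fun s => ((((((upPart s).card : ℕ) : ℝ) - (((downPart s).card : ℕ) : ℝ)) / 2 : ℝ) : ℂ) := by
  rw [LiebThm1.spinZ_eq_diagonal]
  congr 1
  funext s
  push_cast
  ring

omit [LinearOrder Λ] [Fintype Λ] in
/-- Restriction to a set commutes with scalars. [folklore] -/
private theorem indicator_smul_vec_lit (s : Set (Finset (Orb Λ))) (a : ℂ) (ψ : Fock (Orb Λ)) :
    Set.indicator s (a • ψ) = a • Set.indicator s ψ := by
  ext i
  by_cases hi : i ∈ s
  · rw [Set.indicator_of_mem hi, Pi.smul_apply, Pi.smul_apply, Set.indicator_of_mem hi]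
  · rw [Set.indicator_of_notMem hi, Pi.smul_apply, Set.indicator_of_notMem hi, smul_zero]

/-- **An `S^z`-conserving Hermitian operator on the fermionic Fock space has a unit ground-state vector in
some `S^z` eigenspace** (`fockSpinZSector M`): a ground vector has a nonzero fibre component over the
diagonal charge `S^z`, which is again a ground vector (`mulVec_indicator_fiber_of_commute`) and an
`S^z`-eigenvector (`diagonal_mulVec_indicator_fiber`). Han 2020 §3 (symmetry sectors label the degenerate
ground multiplet). [cite: Han2020Bootstrap, §3] -/
theorem exists_unit_groundState_mem_fockSpinZSector (A : Matrix (Finset (Orb Λ)) (Finset (Orb Λ)) ℂ)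
    (hA : A.IsHermitian) (hAS : HubbardWave0.spinZ * A = A * HubbardWave0.spinZ) :
    ∃ (M : ℝ) (ψ : Fock (Orb Λ)), ψ ∈ fockSpinZSector (Λ := Λ) M ∧ star ψ ⬝ᵥ ψ = 1 ∧
      A *ᵥ ψ = ((A.groundEnergy : ℝ) : ℂ) • ψ := by
  obtain ⟨v, hv, hv0⟩ := (Submodule.ne_bot_iff _).1 (groundSpace_ne_bot_holds hA)
  have hAv : A *ᵥ v = ((A.groundEnergy : ℝ) : ℂ) • v := (mem_groundSpace_iff A v).1 hv
  set f : Finset (Orb Λ) → ℝ :=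
    fun s => ((((upPart s).card : ℕ) : ℝ) - (((downPart s).card : ℕ) : ℝ)) / 2 with hf
  have hAD : A * diagonal (fun s => ((f s : ℝ) : ℂ)) = diagonal (fun s => ((f s : ℝ) : ℂ)) * A := by
    rw [hf, ← spinZ_eq_diagonal_ofReal_lit]
    exact hAS.symm
  -- some fibre component of `v` is nonzero
  obtain ⟨M, hM⟩ : ∃ M, Set.indicator {i | f i = M} v ≠ 0 := by
    by_contra hall
    push Not at hall
    apply hv0
    have h1 : (1 : Matrix (Finset (Orb Λ)) (Finset (Orb Λ)) ℂ) * diagonal (fun s => ((f s : ℝ) : ℂ)) =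
        diagonal (fun s => ((f s : ℝ) : ℂ)) * 1 := by rw [Matrix.one_mul, Matrix.mul_one]
    have hs := star_dotProduct_mulVec_eq_sum_fiber h1 v
    rw [one_mulVec] at hs
    have h0 : star v ⬝ᵥ v = 0 := by
      rw [hs]
      exact Finset.sum_eq_zero fun M _ => by rw [hall M]; simp
    exact dotProduct_star_self_eq_zero.mp h0
  obtain ⟨a, -, h1⟩ := exists_smul_unit hM
  refine ⟨M, a • Set.indicator {i | f i = M} v, ?_, h1, ?_⟩
  · rw [mem_fockSpinZSector_iff, spinZ_eq_diagonal_ofReal_lit, mulVec_smul]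
    show a • ((diagonal fun s => ((f s : ℝ) : ℂ)) *ᵥ Set.indicator {i | f i = M} v) = _
    rw [diagonal_mulVec_indicator_fiber f M v, smul_comm]
  · rw [mulVec_smul, mulVec_indicator_fiber_of_commute hAD, hAv, indicator_smul_vec_lit, smul_comm]

end SectorGroundState

/-! ## §2 The energy floor of the pair-sourced `t–t'` torus from a window certificate with a KKT block -/

section TorusSourcedEnergy

variable {L : ℕ} [NeZero L]

/-- (Local to this section, as in `DWaveSourceNNNHoppingWindowCertificate[KKT]`.) [folklore] -/
local instance (priority := high) instDecidableEqFermionTorusSrcTTKKTEnergy : DecidableEq (FermionTorus 2 L) :=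
  LinearOrder.toDecidableEq

/-- **Window certificate with affine `D₄` reductions AND a KKT block ⇒ ground-state energy of EVERY large
pair-sourced `t–t'` torus.** The identity in `𝔄_{Λ'}` (`thicken Λ 1 ⊆ Λ'`, `χ_{B₁g}(γₗ) = 1`, `S^z`-charged `wⱼ`,
`G ⪰ 0`, ARBITRARY generators `B_b ∈ 𝔄_Λ`)
`E^{src,tt'} − c·1 = Σ Λₐᵦ Oₐᴴ O_b + (Σₖ [H^{src,tt'}_{Λ'}, Γ(incl)Bₖ] + Σₗ (Γ(incl)(Γ(d4Emb γₗ vₗ) Yₗ) − Γ(incl) Yₗ)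
 + Σⱼ bⱼ • wⱼ) + (Σₘ dₘ • (Vₘᴴ − Vₘ) + Σₖ aₖ • vₖ) + kktForm H^{src,tt'}_{Λ'} G (Γ(incl) ∘ B)`
gives, for every `L ≥ 3` with `x ↦ x mod L` injective on `thicken Λ' 1`,
`(c − Σₖ ‖aₖ‖) · L² ≤ E₀(dWaveSourceTorusTT' L tp U μ h)` (full Fock space) — the observable row
`re_orbitState_ge_of_sourced_window_certificate_d4_TT'_kkt_ineq` with zero objective and unit energy weight,
read in the orbit state (labels `ker χ_{B₁g}`) of one `S^z`-eigenvector ground vector. [cite: AraujoEtAl2023, §3.2 Prop. 11]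
[cite: Han2020Bootstrap, §3] -/
theorem dWaveSourceTorusTT'_groundEnergy_ge_of_window_certificate_d4_kkt (tp U μ h : ℝ) (hL : 3 ≤ L)
    {Λ Λ' : Finset (Site 2)} (hΛ : Λ ⊆ Λ') (h8 : thicken Λ 1 ⊆ Λ')
    (h0 : thicken ({0} : Finset (Site 2)) 1 ⊆ Λ') (hz : (0 : Site 2) ∈ Λ')
    (hP : pairRegion (insert (0 : Site 2) unitSteps) 0 ⊆ Λ')
    (hInj : Set.InjOn (Torus.proj (d := 2) L) ↑(thicken Λ' 1))
    {m : Type*} [Fintype m] [DecidableEq m] {Λm : Matrix m m ℂ} (hΛm : Λm.PosSemidef)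
    (O : m → FermionOp Λ')
    {κ : Type*} (s : Finset κ) (B : κ → FermionOp Λ)
    {ι : Type*} (tt : Finset ι) (gam : ι → DihedralGroup 4) (v : ι → Site 2)
    (hgam : ∀ l ∈ tt, b1gChar (gam l) = 1) (hsh : ∀ l, d4ShiftSet (gam l) (v l) Λ ⊆ Λ') (Y : ι → FermionOp Λ)
    {χ : Type*} (u : Finset χ) (b : χ → ℂ) (cw : χ → List (Orb (PolySite Λ') × Bool))
    (hcw : ∀ j ∈ u, ladderSpinCharge (cw j) ≠ 0)
    {δ : Type*} (ah : Finset δ) (dc : δ → ℝ) (V : δ → FermionOp Λ')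
    {κ'' : Type*} (w : Finset κ'') (a : κ'' → ℂ) (word : κ'' → List (Orb (PolySite Λ') × Bool))
    {β : Type*} [Fintype β] [DecidableEq β] {G : Matrix β β ℂ} (hG : G.PosSemidef)
    (Bk : β → FermionOp Λ) {c : ℝ}
    (hcert : fermionEmbed (PolySite.incl h0) ((hubbardTTPrimeFermionInteraction 1 tp U).meanEnergyObs 1) -
          (μ : ℂ) • ∑ σ : Fin 2, nAt 0 hz σ -
          (h : ℂ) • (fermionEmbed (PolySite.incl hP) (localPairAt (insert (0 : Site 2) unitSteps) dWaveFormFactor 0) +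
            (fermionEmbed (PolySite.incl hP) (localPairAt (insert (0 : Site 2) unitSteps) dWaveFormFactor 0))ᴴ) -
        (c : ℂ) • (1 : FermionOp Λ') =
      gramForm Λm O +
        (∑ k ∈ s, (pairSourceWindowHamiltonianTT' dWaveFormFactor Λ' tp U μ h * fermionEmbed (PolySite.incl hΛ) (B k) -
            fermionEmbed (PolySite.incl hΛ) (B k) * pairSourceWindowHamiltonianTT' dWaveFormFactor Λ' tp U μ h) +
          ∑ l ∈ tt, (fermionEmbed (PolySite.incl (hsh l)) (fermionEmbed (PolySite.d4Emb (gam l) (v l) Λ) (Y l)) -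
            fermionEmbed (PolySite.incl hΛ) (Y l)) +
          ∑ j ∈ u, b j • ladderWord (cw j)) +
        (∑ m' ∈ ah, ((dc m' : ℝ) : ℂ) • ((V m')ᴴ - V m') + ∑ k ∈ w, a k • ladderWord (word k)) +
        kktForm (pairSourceWindowHamiltonianTT' dWaveFormFactor Λ' tp U μ h) G
          (fun b' => fermionEmbed (PolySite.incl hΛ) (Bk b'))) :
    (c - ∑ k ∈ w, ‖a k‖) * (L : ℝ) ^ 2 ≤ (dWaveSourceTorusTT' L tp U μ h).groundEnergy := by
  classical
  have hInj' : Set.InjOn (Torus.proj (d := 2) L) ↑Λ' := hInj.mono (by exact_mod_cast subset_thicken Λ' 1)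
  -- the label set: the kernel of `χ_{B₁g}`
  set S : Finset (DihedralGroup 4) := Finset.univ.filter fun γ => b1gChar γ = 1 with hSdef
  have hmemS : ∀ γ, γ ∈ S ↔ b1gChar γ = 1 := fun γ => by
    rw [hSdef, Finset.mem_filter]
    exact ⟨fun h' => h'.2, fun h' => ⟨Finset.mem_univ _, h'⟩⟩
  have h1S : (1 : DihedralGroup 4) ∈ S := (hmemS 1).2 b1gChar_one
  have hmulS : ∀ a' ∈ S, ∀ b' ∈ S, a' * b' ∈ S := fun a' ha' b' hb' =>
    (hmemS _).2 (by rw [b1gChar_mul_holds, (hmemS _).1 ha', (hmemS _).1 hb', one_mul])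
  have hSχ : ∀ γ ∈ S, b1gChar γ = 1 := fun γ hγ => (hmemS γ).1 hγ
  have hγS : ∀ l ∈ tt, gam l ∈ S := fun l hl => (hmemS _).2 (hgam l hl)
  -- one `S^z`-eigenvector ground vector
  obtain ⟨M, ψ, hψK, hψ1, hHψ⟩ := exists_unit_groundState_mem_fockSpinZSector
    (dWaveSourceTorusTT' L tp U μ h) (dWaveSourceTorusTT'_isHermitian L tp U μ h)
    (spinZ_mul_dWaveSourceTorusTT' (L := L) tp U μ h)
  -- the energy identity as an observable identity with zero objective and unit energy weight
  have hcert' : (0 : FermionOp Λ') - (((0 : ℝ) : ℝ) : ℂ) • (1 : FermionOp Λ') -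
      (((1 : ℝ) : ℝ) : ℂ) • ((((c : ℝ) : ℝ) : ℂ) • (1 : FermionOp Λ') -
        (fermionEmbed (PolySite.incl h0) ((hubbardTTPrimeFermionInteraction 1 tp U).meanEnergyObs 1) -
          (μ : ℂ) • ∑ σ : Fin 2, nAt 0 hz σ -
          (h : ℂ) • (fermionEmbed (PolySite.incl hP) (localPairAt (insert (0 : Site 2) unitSteps) dWaveFormFactor 0) +
            (fermionEmbed (PolySite.incl hP) (localPairAt (insert (0 : Site 2) unitSteps) dWaveFormFactor 0))ᴴ))) =
      gramForm Λm O +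
        (∑ k ∈ s, (pairSourceWindowHamiltonianTT' dWaveFormFactor Λ' tp U μ h * fermionEmbed (PolySite.incl hΛ) (B k) -
            fermionEmbed (PolySite.incl hΛ) (B k) * pairSourceWindowHamiltonianTT' dWaveFormFactor Λ' tp U μ h) +
          ∑ l ∈ tt, (fermionEmbed (PolySite.incl (hsh l)) (fermionEmbed (PolySite.d4Emb (gam l) (v l) Λ) (Y l)) -
            fermionEmbed (PolySite.incl hΛ) (Y l)) +
          ∑ j ∈ u, b j • ladderWord (cw j)) +
        (∑ m' ∈ ah, ((dc m' : ℝ) : ℂ) • ((V m')ᴴ - V m') + ∑ k ∈ w, a k • ladderWord (word k)) +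
        kktForm (pairSourceWindowHamiltonianTT' dWaveFormFactor Λ' tp U μ h) G
          (fun b' => fermionEmbed (PolySite.incl hΛ) (Bk b')) := by
    rw [Complex.ofReal_zero, zero_smul, sub_zero, Complex.ofReal_one, one_smul, zero_sub, neg_sub]
    exact hcert
  have hmain := re_orbitState_ge_of_sourced_window_certificate_d4_TT'_kkt_ineq tp U μ h hL hΛ h8 h0 hz hP hInj
    hInj' h1S hmulS hSχ hψK hψ1 hHψ 0 1 c hΛm O s B tt gam hγS v hsh Y u b cw hcw ah dc V w a word hG Bk hcert'
  rw [map_zero, map_zero, Complex.zero_re] at hmain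
  have hL2 : (0 : ℝ) < (L : ℝ) ^ 2 := by
    have : (0 : ℝ) < (L : ℝ) := by exact_mod_cast Nat.pos_of_ne_zero (NeZero.ne L)
    positivity
  have hle : c - ∑ k ∈ w, ‖a k‖ ≤ (dWaveSourceTorusTT' L tp U μ h).groundEnergy / (L : ℝ) ^ 2 := by linarith
  exact (le_div_iff₀ hL2).1 hle

end TorusSourcedEnergy

/-- **Eventual form** (library instances; the FLOOR slot `Summit.Ventures.CertifiedManyBodySolver.SourcedEnergyLowerRow`):
there is `L₀` (`= max 3 L₁`, `L₁` from `exists_forall_le_injOn_proj (thicken Λ' 1)`) with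
`(c − Σₖ ‖aₖ‖) · L² ≤ E₀(dWaveSourceTorusTT' L tp U μ h)` for every `L ≥ L₀`, from ONE window identity with a
KKT block. [cite: AraujoEtAl2023, §3.2 Prop. 11] [cite: Han2020Bootstrap, §3] -/
theorem dWaveSourceTorusTT'_groundEnergy_ge_of_window_certificate_d4_kkt_eventually (tp U μ h : ℝ)
    {Λ Λ' : Finset (Site 2)} (hΛ : Λ ⊆ Λ') (h8 : thicken Λ 1 ⊆ Λ')
    (h0 : thicken ({0} : Finset (Site 2)) 1 ⊆ Λ') (hz : (0 : Site 2) ∈ Λ')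
    (hP : pairRegion (insert (0 : Site 2) unitSteps) 0 ⊆ Λ')
    {m : Type*} [Fintype m] [DecidableEq m] {Λm : Matrix m m ℂ} (hΛm : Λm.PosSemidef)
    (O : m → FermionOp Λ')
    {κ : Type*} (s : Finset κ) (B : κ → FermionOp Λ)
    {ι : Type*} (tt : Finset ι) (gam : ι → DihedralGroup 4) (v : ι → Site 2)
    (hgam : ∀ l ∈ tt, b1gChar (gam l) = 1) (hsh : ∀ l, d4ShiftSet (gam l) (v l) Λ ⊆ Λ') (Y : ι → FermionOp Λ)
    {χ : Type*} (u : Finset χ) (b : χ → ℂ) (cw : χ → List (Orb (PolySite Λ') × Bool))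
    (hcw : ∀ j ∈ u, ladderSpinCharge (cw j) ≠ 0)
    {δ : Type*} (ah : Finset δ) (dc : δ → ℝ) (V : δ → FermionOp Λ')
    {κ'' : Type*} (w : Finset κ'') (a : κ'' → ℂ) (word : κ'' → List (Orb (PolySite Λ') × Bool))
    {β : Type*} [Fintype β] [DecidableEq β] {G : Matrix β β ℂ} (hG : G.PosSemidef)
    (Bk : β → FermionOp Λ) {c : ℝ}
    (hcert : fermionEmbed (PolySite.incl h0) ((hubbardTTPrimeFermionInteraction 1 tp U).meanEnergyObs 1) -
          (μ : ℂ) • ∑ σ : Fin 2, nAt 0 hz σ -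
          (h : ℂ) • (fermionEmbed (PolySite.incl hP) (localPairAt (insert (0 : Site 2) unitSteps) dWaveFormFactor 0) +
            (fermionEmbed (PolySite.incl hP) (localPairAt (insert (0 : Site 2) unitSteps) dWaveFormFactor 0))ᴴ) -
        (c : ℂ) • (1 : FermionOp Λ') =
      gramForm Λm O +
        (∑ k ∈ s, (pairSourceWindowHamiltonianTT' dWaveFormFactor Λ' tp U μ h * fermionEmbed (PolySite.incl hΛ) (B k) -
            fermionEmbed (PolySite.incl hΛ) (B k) * pairSourceWindowHamiltonianTT' dWaveFormFactor Λ' tp U μ h) +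
          ∑ l ∈ tt, (fermionEmbed (PolySite.incl (hsh l)) (fermionEmbed (PolySite.d4Emb (gam l) (v l) Λ) (Y l)) -
            fermionEmbed (PolySite.incl hΛ) (Y l)) +
          ∑ j ∈ u, b j • ladderWord (cw j)) +
        (∑ m' ∈ ah, ((dc m' : ℝ) : ℂ) • ((V m')ᴴ - V m') + ∑ k ∈ w, a k • ladderWord (word k)) +
        kktForm (pairSourceWindowHamiltonianTT' dWaveFormFactor Λ' tp U μ h) G
          (fun b' => fermionEmbed (PolySite.incl hΛ) (Bk b'))) :
    ∃ L₀ : ℕ, ∀ (L : ℕ) [NeZero L], L₀ ≤ L →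
      (c - ∑ k ∈ w, ‖a k‖) * (L : ℝ) ^ 2 ≤ (dWaveSourceTorusTT' L tp U μ h).groundEnergy := by
  obtain ⟨L₁, hL₁⟩ := exists_forall_le_injOn_proj (thicken Λ' 1)
  refine ⟨max 3 L₁, fun L _ hL => ?_⟩
  convert dWaveSourceTorusTT'_groundEnergy_ge_of_window_certificate_d4_kkt tp U μ h (le_trans (le_max_left _ _) hL) hΛ
    h8 h0 hz hP (hL₁ L (le_trans (le_max_right _ _) hL)) hΛm O s B tt gam v hgam hsh Y u b cw hcw ah dc V w a
    word hG Bk hcert using 2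

end Literature.MathematicalPhysics.QuantumLattice

end
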